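import Summits.PneNP.PneNP.Theorems.SingleThreshold.Negative.LoadBearing

/-!
# `SingleThreshold` (stmt-PneNP-2833) — negative-side lemmas II: equivalence with the a.a.s. form

`singleThreshold_implies_aas` (fixed `δ` ⇒ a.a.s., `aasLowerBoundAt_of_lowerBoundAt`),
`exists_lowerBoundAt_of_aas` (a.a.s. ⇒ some `δ > 0` works, by a diagonal splice along
`Filter.extraction_forall_of_frequently`: bad circuits with error `≤ 1/(j+1)` spliced with the exact
DNF `fallback`), `not_aas_of_not_singleThreshold`, `singleThreshold_iff_aas` — **the crux is EXACTLY
Rossman's single-threshold problem (FOCS 2010, §9) in the unbounded-exponent form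
`∀ c ∃ k ≥ 3, AASLowerBoundAt c k`**: a kill of the crux is a fixed-exponent a.a.s. monotone
`k`-clique detector at `p_c` for every `k`, and conversely.
Refuter seat cdisprove-stmt-PneNP-2833 (gen 1), 2026-08-16.
-/

namespace Summit.PneNP.PneNP.Theorems.SingleThreshold.Negative

open Literature.Computability.Complexity Finset Filter Classical
open Summit.PneNP.PneNP.Theses.OneSlice (SingleThreshold)

noncomputable section

/-! ## §4 Equivalence with Rossman's a.a.s. single-threshold problem -/

/-- The a.a.s. (error `→ 0`) single-threshold lower-bound MATRIX at exponent `c` and clique size `k`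
over `{∧₂, ∨₂}`: every eventually-monotone sequence of circuits that solves `k`-CLIQUE a.a.s. on
`G(n, p_c)` has eventually more than `n^c` gates (a definition, not a claim; the question whether
`∀ c, ∃ k ≥ 3, AASLowerBoundAt c k` holds is the one posed in Rossman 2010, §9, p. 11 of the held
text, and is equivalent to the crux by `singleThreshold_iff_aas`). [folklore] -/
def AASLowerBoundAt (c k : ℕ) : Prop :=
  ∀ C : (n : ℕ) → Circuit (Edges n), (∀ᶠ n : ℕ in atTop, (C n).IsOver monotoneBasis) →
    SolvesCliqueAAS k (fun n => pc n k) C → ∀ᶠ n : ℕ in atTop, n ^ c < (C n).size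

/-- Fixed `δ` implies a.a.s.: an a.a.s.-correct sequence is eventually `δ`-accurate. [folklore] -/
theorem aasLowerBoundAt_of_lowerBoundAt {c k : ℕ} {δ : ℝ} (hδ : 0 < δ) (h : LowerBoundAt c k δ) :
    AASLowerBoundAt c k := by
  intro C hC hsolve
  have hsmall : ∀ᶠ n : ℕ in atTop, err n k (C n) ≤ δ :=
    (hsolve.eventually (eventually_le_nhds hδ)).mono fun n hn => hn
  filter_upwards [h, hC, hsmall] with n hn hCn hsm
  exact hn (C n) hCn hsm

/-- The crux implies Rossman's a.a.s. single-threshold lower bound (unbounded-exponent form).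
[folklore] -/
theorem singleThreshold_implies_aas :
    SingleThreshold → ∀ c : ℕ, ∃ k : ℕ, 3 ≤ k ∧ AASLowerBoundAt c k := by
  intro h c
  obtain ⟨k, hk3, δ, hδ, hev⟩ := (singleThreshold_iff_lib.1 h) c
  exact ⟨k, hk3, aasLowerBoundAt_of_lowerBoundAt hδ hev⟩

/-- A default monotone-or-not circuit at every `n`: the exact DNF when `2 ≤ k ≤ n`, else a constant.
[folklore] -/
def fallback (n k : ℕ) : Circuit (Edges n) :=
  if h : 2 ≤ k ∧ k ≤ n then (exists_monotone_cliqueCircuit h.1 h.2).choose else Circuit.const _ false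

/-- The fallback circuit is monotone and exact once `2 ≤ k ≤ n`. [folklore] -/
theorem fallback_spec {n k : ℕ} (h2 : 2 ≤ k) (hkn : k ≤ n) :
    (fallback n k).IsOver monotoneBasis ∧ ∀ x, (fallback n k).eval x = cliqueFn n k x := by
  have h : 2 ≤ k ∧ k ≤ n := ⟨h2, hkn⟩
  simp only [fallback, h, and_self, ↓reduceDIte]
  exact ⟨(exists_monotone_cliqueCircuit h2 hkn).choose_spec.1,
    (exists_monotone_cliqueCircuit h2 hkn).choose_spec.2.2⟩

/-- An exact circuit has error `0`. [folklore] -/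
theorem err_eq_zero_of_exact {n k : ℕ} {C : Circuit (Edges n)} (h : ∀ x, C.eval x = cliqueFn n k x) :
    err n k C = 0 := by
  have : (univ.filter fun x => C.eval x ≠ cliqueFn n k x) = ∅ := by simp [h]
  simp [err, this, gnpProb]

/-- `0 ≤ err`. [folklore] -/
theorem err_nonneg {n k : ℕ} (hn : 1 ≤ n) (hk : 2 ≤ k) (C : Circuit (Edges n)) : 0 ≤ err n k C :=
  gnpProb_nonneg (pc_nonneg n k) (pc_le_one hn hk) _

/-- **The converse: the a.a.s. form implies the crux** (diagonal/splicing argument). If for some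
exponent `c` and clique size `k` NO `δ > 0` works, then for every `j` there are, infinitely often in
`n`, monotone circuits of size `≤ n^c` with error `≤ 1/(j+1)`; extracting a strictly increasing
subsequence and splicing these circuits with the exact DNF elsewhere yields ONE a.a.s.-correct
sequence of size `≤ n^c` infinitely often, contradicting the a.a.s. lower bound. Hence the crux is
EQUIVALENT to Rossman's single-threshold problem in the `∀ c ∃ k` a.a.s. form. [folklore] -/
theorem exists_lowerBoundAt_of_aas {c k : ℕ} (hk3 : 3 ≤ k) (H : AASLowerBoundAt c k) :
    ∃ δ : ℝ, 0 < δ ∧ LowerBoundAt c k δ := by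
  by_contra hno
  simp only [LowerBoundAt] at hno
  push Not at hno
  -- `hno : ∀ δ, 0 < δ → ¬ ∀ᶠ n, ∀ C mono, err ≤ δ → n^c < size`
  have hfreq : ∀ j : ℕ, ∃ᶠ n in atTop, ∃ C : Circuit (Edges n),
      C.IsOver monotoneBasis ∧ err n k C ≤ 1 / ((j : ℝ) + 1) ∧ C.size ≤ n ^ c := by
    intro j
    have hj : (0 : ℝ) < 1 / ((j : ℝ) + 1) := by positivity
    exact hno _ hj
  obtain ⟨φ, hφ, hbad⟩ := extraction_forall_of_frequently hfreq
  -- the spliced sequence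
  let Q : ℕ → ℕ → Prop := fun j n => ∃ C : Circuit (Edges n),
    C.IsOver monotoneBasis ∧ err n k C ≤ 1 / ((j : ℝ) + 1) ∧ C.size ≤ n ^ c
  have hQ : ∀ j, Q j (φ j) := hbad
  let S : (n : ℕ) → Circuit (Edges n) := fun n =>
    if h : ∃ j, φ j = n ∧ Q j n then h.choose_spec.2.choose else fallback n k
  -- on the subsequence, `S` is the bad circuit
  have hS_on : ∀ j, (S (φ j)).IsOver monotoneBasis ∧
      err (φ j) k (S (φ j)) ≤ 1 / ((j : ℝ) + 1) ∧ (S (φ j)).size ≤ (φ j) ^ c := by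
    intro j
    have hex : ∃ i, φ i = φ j ∧ Q i (φ j) := ⟨j, rfl, hQ j⟩
    have hdef : S (φ j) = hex.choose_spec.2.choose := by simp only [S, dif_pos hex]
    have hi : hex.choose = j := hφ.injective hex.choose_spec.1
    have key : ∀ i (hq : Q i (φ j)), i = j → (hq.choose.IsOver monotoneBasis ∧
        err (φ j) k hq.choose ≤ 1 / ((j : ℝ) + 1) ∧ hq.choose.size ≤ (φ j) ^ c) := by
      rintro i hq rfl
      exact hq.choose_spec
    rw [hdef]
    exact key _ hex.choose_spec.2 hi
  -- off the subsequence, `S` is the fallback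
  have hS_off : ∀ n, (¬ ∃ j, φ j = n) → S n = fallback n k := by
    intro n hn
    have : ¬ ∃ j, φ j = n ∧ Q j n := fun ⟨j, hj, _⟩ => hn ⟨j, hj⟩
    simp only [S, dif_neg this]
  have hk2 : 2 ≤ k := by omega
  -- `S` is eventually monotone
  have hmono : ∀ᶠ n in atTop, (S n).IsOver monotoneBasis := by
    filter_upwards [eventually_ge_atTop k] with n hn
    by_cases h : ∃ j, φ j = n
    · obtain ⟨j, rfl⟩ := h
      exact (hS_on j).1
    · rw [hS_off n h]
      exact (fallback_spec hk2 hn).1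
  -- `S` is a.a.s. correct
  have haas : SolvesCliqueAAS k (fun n => pc n k) S := by
    rw [SolvesCliqueAAS, Metric.tendsto_atTop]
    intro ε hε
    obtain ⟨J, hJ⟩ := exists_nat_gt (1 / ε)
    refine ⟨max k (φ J), fun n hn => ?_⟩
    have hnk : k ≤ n := le_of_max_le_left hn
    have hn1 : 1 ≤ n := by omega
    rw [Real.dist_eq, sub_zero]
    change |err n k (S n)| < ε
    rw [abs_of_nonneg (err_nonneg hn1 hk2 _)]
    by_cases h : ∃ j, φ j = n
    · obtain ⟨j, rfl⟩ := h
      have hjJ : J ≤ j := hφ.le_iff_le.1 (le_of_max_le_right hn)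
      have h1 : err (φ j) k (S (φ j)) ≤ 1 / ((j : ℝ) + 1) := (hS_on j).2.1
      have h2 : 1 / ((j : ℝ) + 1) < ε := by
        have hjJ' : (J : ℝ) ≤ j := by exact_mod_cast hjJ
        rw [div_lt_iff₀ (by positivity)]
        rw [div_lt_iff₀ hε] at hJ
        nlinarith
      linarith
    · rw [hS_off n h, err_eq_zero_of_exact (fallback_spec hk2 hnk).2]
      exact hε
  -- but `S` is small infinitely often
  have hlarge := H S hmono haas
  obtain ⟨N, hN⟩ := eventually_atTop.1 hlarge
  have hφN : N ≤ φ N := hφ.id_le N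
  have h1 := hN (φ N) hφN
  have h2 := (hS_on N).2.2
  omega

/-- **Killing the crux kills Rossman's a.a.s. problem**: `¬ crux → ¬ (∀ c ∃ k ≥ 3, AASLowerBoundAt c k)`
(contrapositive of `exists_lowerBoundAt_of_aas`). With `singleThreshold_implies_aas` the crux is
EQUIVALENT to the a.a.s. single-threshold lower bound in the unbounded-exponent form. [folklore] -/
theorem not_aas_of_not_singleThreshold (h : ¬ SingleThreshold) :
    ¬ ∀ c : ℕ, ∃ k : ℕ, 3 ≤ k ∧ AASLowerBoundAt c k := by
  intro hA
  apply h
  rw [singleThreshold_iff_lib]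
  intro c
  obtain ⟨k, hk3, H⟩ := hA c
  exact ⟨k, hk3, exists_lowerBoundAt_of_aas hk3 H⟩

/-- **The crux is exactly Rossman's a.a.s. single-threshold problem (unbounded-exponent form).**
[folklore] -/
theorem singleThreshold_iff_aas :
    SingleThreshold ↔ ∀ c : ℕ, ∃ k : ℕ, 3 ≤ k ∧ AASLowerBoundAt c k :=
  ⟨singleThreshold_implies_aas, fun hA => by_contra fun h => not_aas_of_not_singleThreshold h hA⟩


end

end Summit.PneNP.PneNP.Theorems.SingleThreshold.Negative
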